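import Summits.HodgeConjecture.HodgeConjecture.Theorems.Ring2AbelianAllAndreLerayIdempotentNodes
import Summits.HodgeConjecture.HodgeConjecture.Statement
import Literature.AlgebraicGeometry.HodgeTheory.HodgeRiemannPolarizabilityProofs
import Literature.AlgebraicGeometry.HodgeTheory.HodgeClassOfMorphismDischarge
import Literature.AlgebraicGeometry.HodgeTheory.HodgeStructureOfHodgeModel
import Literature.AlgebraicGeometry.HodgeTheory.ClassesSupportedOnComplexification
import Literature.AlgebraicGeometry.Motives.HodgeStructureSemisimple
import HarnessLib

/-!
# Ring 2 · sub-cell AbelianAll (ALL ABELIAN VARIETIES), André axis, part XXVII-d — THE ALGEBRAIC LERAY IDEMPOTENT IS ON-PATH: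
# `HodgeConjecture ⟹ CMLerayIdempotent[]` (semisimplicity of polarisable Hodge structures + Voisin I Lemma 11.41 + HC on `𝒳 × 𝒳`)

HONEST FRAMING (page 1, verbatim): **research route, not a corollary; conditional on HC_CM plus one named
minimal statement.** Cell line: research route conditional on HC_CM; not a corollary; Q11.4-sentence-2
already refuted in dim ≥ 3. Nothing in this file proves a case of the Hodge conjecture for an abelian variety; `HC_CM` does not occur;
the summit statement `HodgeConjecture` occurs ONLY as the hypothesis of the on-path lemmas of §3 (the trivial direction: the displayed
bracket is a CASE of the summit). Item `Theses.RankFourFaces.CMToAbelian` (stmt-16267) OPEN and not closed here. Seat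
`pub-hodge-ring2-ab-andre-2`, gen 19; brief: "each with its ON-PATH lemma `<target>_of_HodgeConjecture` (trivial direction, proves the
target is a CASE of the summit) so nothing here is summit-progress rhetoric".

## Why this file

Parts XXIV–XXVI displayed the abelian-scheme structure (θ∀) `PencilTheta[]` — a statement about MORPHISMS of schemes over `S`, true in
print (Mumford GIT 6.14) but NOT a consequence of the Hodge conjecture: it had no on-path lemma. Part XXVII-c replaced it by
`CMLerayIdempotent[]` (one algebraic cycle per pencil / CM point / degree with a linear-algebra specification). THIS FILE proves that the
new bracket IS a case of the summit: `HodgeConjecture ⟹ CMLerayIdempotent[]`. Hence every displayed hypothesis of the André-axis exactness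
row `HC_AV ⟺ HC_CM ∧ CMIdempotentHodge[]` other than the two Literature facts ([h₂₁] André Lemme 6.3.1, Verdier 1976) is now ON-PATH.

## What is proved (theorems only; no definition, no named fact, no sorry)

§1 ABSTRACT (`Motives.HodgeStructure`): for complementary sub-Hodge structures `K ⊕ K₀ = V` of a `ℚ`-Hodge structure `H`, every Hodge
piece splits, `V^{i,n-i} = (K_ℂ ∩ V^{i,n-i}) ⊕ (K₀,ℂ ∩ V^{i,n-i})` (`piece_le_sup_inf_of_isCompl`; independence of the pieces, Deligne
1.2.5, and "a sub-Hodge structure is the sum of its Hodge components", Voisin I Def. 7.24 — tree theorems), so the complexified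
PROJECTION onto `K` along `K₀` preserves every piece (`projection_baseChange_mem_piece`): the projection is a morphism of Hodge structures
(Voisin 2025, proof of Cor. 2.12: "`φ` has a left inverse as morphism of Hodge structures").
§2 CARRIERS: **`exists_hodge_idempotent_of_map`** — for a morphism `g : Y ⟶ X` of smooth projective varieties and a degree `k`, there is an
endomorphism `e` of `Hᵏ(X(ℂ); ℂ)` preserving rational classes and Hodge types with `g^* ∘ e = g^*` and `e|_{ker g^*} = 0`: the kernel of
`g^* : Hᵏ(X, ℚ) → Hᵏ(Y, ℚ)` underlies a sub-Hodge structure (tree: `Hom.exists_subHodgeStructure_ker` for the model Hodge structures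
`HodgeModel.hodgeStructure`, `hodgeStructureHom`), the Hodge structure of `X` is polarisable (tree: `smoothProjective_hodgeStructure_isPolarizable_holds`,
Hodge–Riemann), so the kernel has a complementary sub-Hodge structure (tree: `SubHodgeStructure.exists_isCompl_eq_orthogonal`, Voisin
2025 Prop. 2.11), and `e` is the complexified projection, read on `Hᵏ(X(ℂ); ℂ) = ℂ ⊗ Hᵏ(X, ℚ)` (`ofRatClassBaseChangeEquiv`).
§3 ON-PATH: **`exists_lerayIdempotent_of_hodgeConjecture`** — on a compact abelian pencil, at every point `t`, in every degree `2p ≤ 2(d+1)`,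
`HodgeConjecture` gives an algebraic Leray idempotent with (Π1), (Π2), (π), (κ): the `e` of §2 for `j_t` is `t⁻¹ • γ_*` for a RATIONAL
HODGE class `γ` on `𝒳 × 𝒳` (Voisin I Lemma 11.41, the tree's discharged `exists_hodgeClass_corrAction_eq_smul_holds`), and `HodgeConjecture`
for the smooth projective `𝒳 × 𝒳` makes `γ` algebraic; node level **`cmLerayIdempotent_of_hodgeConjecture : HodgeConjecture → CMLerayIdempotent[]`**.

## Honest status

No node is born; nothing is minimal; nothing here is progress on `HC_AV` (the direction proved is the trivial one, summit ⟹ bracket). What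
is gained is TAXONOMIC and exact: `CMLerayIdempotent[]` is a CASE OF THE HODGE CONJECTURE (for the products `𝒳 × 𝒳` of total spaces of
compact abelian pencils, degree `2(d+1)`), which (θ∀) was not; and §2 is a fact-free tool (the Hodge-theoretic Leray idempotent exists for
every morphism of smooth projective varieties). The CM point plays no role in §3.

References: Voisin2025 (Prop. 2.11, Cor. 2.12); VoisinHodgeI2002 (§7.1.1–7.1.2, Lemma 7.26, §7.3.1 Def. 7.24, §11.3.3 Lemma 11.41);
DeligneHodgeII1971 (1.2.5, 2.1); Deligne2000 (§1); DeningerMurre1991 (Thm. 3.1); Andre1996Motifs (§5.1, Remarque 2).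
-/

noncomputable section

set_option linter.dupNamespace false

namespace Summit.HodgeConjecture.HodgeConjecture.Ring2.AbelianAll

open CategoryTheory AlgebraicGeometry MonoidalCategory
open scoped TensorProduct
open Literature.AlgebraicGeometry Literature.AlgebraicGeometry.Motives
open Literature.AlgebraicGeometry.HodgeTheory
open Literature.AlgebraicGeometry.Motives.HodgeStructure
open Literature.AlgebraicGeometry.Deligne1982 (cmLocus)

/-! ## §1 Abstract: the projection onto a complementary sub-Hodge structure preserves the Hodge pieces -/

section Abstract

universe u

variable {V : Type u} [AddCommGroup V] [Module ℚ V]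

/-- The complexified projection onto `K` along `K₀` is the identity on `K_ℂ`. [folklore] -/
theorem projection_baseChange_apply_of_mem_left (K K₀ : Submodule ℚ V) (hc : IsCompl K K₀) {y : ℂ ⊗[ℚ] V}
    (hy : y ∈ K.baseChange ℂ) : (K.projection K₀ hc).baseChange ℂ y = y := by
  obtain ⟨z, rfl⟩ := hy
  induction z using TensorProduct.induction_on with
  | zero => simp only [map_zero]
  | tmul c v =>
    rw [LinearMap.baseChange_tmul, LinearMap.baseChange_tmul, Submodule.subtype_apply, Submodule.projection_apply_left]
  | add a b ha hb => simp only [map_add, ha, hb]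

/-- The complexified projection onto `K` along `K₀` kills `K₀,ℂ`. [folklore] -/
theorem projection_baseChange_apply_of_mem_right (K K₀ : Submodule ℚ V) (hc : IsCompl K K₀) {y : ℂ ⊗[ℚ] V}
    (hy : y ∈ K₀.baseChange ℂ) : (K.projection K₀ hc).baseChange ℂ y = 0 := by
  obtain ⟨z, rfl⟩ := hy
  induction z using TensorProduct.induction_on with
  | zero => simp only [map_zero]
  | tmul c v =>
    rw [LinearMap.baseChange_tmul, LinearMap.baseChange_tmul, Submodule.subtype_apply, Submodule.projection_apply_right,
      TensorProduct.tmul_zero]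
  | add a b ha hb => rw [map_add, map_add, ha, hb, add_zero]

/-- The complexified projection lands in `K_ℂ`. [folklore] -/
theorem projection_baseChange_mem_left (K K₀ : Submodule ℚ V) (hc : IsCompl K K₀) (x : ℂ ⊗[ℚ] V) :
    (K.projection K₀ hc).baseChange ℂ x ∈ K.baseChange ℂ := by
  induction x using TensorProduct.induction_on with
  | zero => rw [map_zero]; exact Submodule.zero_mem _
  | tmul c v =>
    rw [LinearMap.baseChange_tmul]
    exact Submodule.tmul_mem_baseChange_of_mem c (Submodule.projection_apply_mem hc v)
  | add a b ha hb => rw [map_add]; exact Submodule.add_mem _ ha hb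

/-- `x − π_ℂ x ∈ K₀,ℂ`. [folklore] -/
theorem sub_projection_baseChange_mem_right (K K₀ : Submodule ℚ V) (hc : IsCompl K K₀) (x : ℂ ⊗[ℚ] V) :
    x - (K.projection K₀ hc).baseChange ℂ x ∈ K₀.baseChange ℂ := by
  induction x using TensorProduct.induction_on with
  | zero => rw [map_zero, sub_zero]; exact Submodule.zero_mem _
  | tmul c v =>
    rw [LinearMap.baseChange_tmul, ← TensorProduct.tmul_sub]
    exact Submodule.tmul_mem_baseChange_of_mem c (Submodule.sub_projection_mem hc v)
  | add a b ha hb =>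
    rw [map_add, show a + b - ((K.projection K₀ hc).baseChange ℂ a + (K.projection K₀ hc).baseChange ℂ b) =
      (a - (K.projection K₀ hc).baseChange ℂ a) + (b - (K.projection K₀ hc).baseChange ℂ b) by abel]
    exact Submodule.add_mem _ ha hb

/-- `V_ℂ = K_ℂ + K₀,ℂ` for complementary `ℚ`-subspaces. [folklore] -/
theorem top_le_baseChange_sup_baseChange (K K₀ : Submodule ℚ V) (hc : IsCompl K K₀) :
    (⊤ : Submodule ℂ (ℂ ⊗[ℚ] V)) ≤ K.baseChange ℂ ⊔ K₀.baseChange ℂ := by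
  intro x _
  rw [show x = (K.projection K₀ hc).baseChange ℂ x + (x - (K.projection K₀ hc).baseChange ℂ x) by abel]
  exact Submodule.add_mem_sup (projection_baseChange_mem_left K K₀ hc x) (sub_projection_baseChange_mem_right K K₀ hc x)

variable {n : ℤ}

/-- **The Hodge pieces split along complementary sub-Hodge structures**: for sub-Hodge structures `K`, `K₀` of `H` with `V = K ⊕ K₀`,
`V^{i,n−i} ⊆ (K_ℂ ∩ V^{i,n−i}) + (K₀,ℂ ∩ V^{i,n−i})`. Proof: `Q_j := (K_ℂ ∩ V^{j}) + (K₀,ℂ ∩ V^{j}) ⊆ V^{j}` and `Σ_j Q_j = V_ℂ` (each of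
`K_ℂ`, `K₀,ℂ` is the sum of its Hodge components — Voisin I Def. 7.24, tree theorem `SubHodgeStructure.baseChange_le_iSup_inf`); for
`x ∈ V^{i}` write `x = y + z`, `y ∈ Q_i`, `z ∈ Σ_{j ≠ i} Q_j ⊆ Σ_{j ≠ i} V^{j}`; then `z = x − y ∈ V^{i}` vanishes by the independence of the
pieces (Deligne 1.2.5, tree theorem `iSupIndep_piece_holds`). [cite: VoisinHodgeI2002, §7.3.1 Def. 7.24 and Lemma 7.26] [cite: DeligneHodgeII1971, 1.2.5] -/
theorem piece_le_sup_inf_of_isCompl (H : Motives.HodgeStructure V n) (K K₀ : SubHodgeStructure H)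
    (hc : IsCompl K.toSubmodule K₀.toSubmodule) (i : ℤ) :
    H.piece i (n - i) ≤ K.toSubmodule.baseChange ℂ ⊓ H.piece i (n - i) ⊔ K₀.toSubmodule.baseChange ℂ ⊓ H.piece i (n - i) := by
  set P : ℤ → Submodule ℂ (ℂ ⊗[ℚ] V) := fun j ↦ H.piece j (n - j) with hP
  set Q : ℤ → Submodule ℂ (ℂ ⊗[ℚ] V) :=
    fun j ↦ K.toSubmodule.baseChange ℂ ⊓ P j ⊔ K₀.toSubmodule.baseChange ℂ ⊓ P j with hQ
  have hQP : ∀ j, Q j ≤ P j := fun j ↦ sup_le inf_le_right inf_le_right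
  have hQtop : (⊤ : Submodule ℂ (ℂ ⊗[ℚ] V)) ≤ ⨆ j, Q j :=
    calc (⊤ : Submodule ℂ (ℂ ⊗[ℚ] V)) ≤ K.toSubmodule.baseChange ℂ ⊔ K₀.toSubmodule.baseChange ℂ :=
          top_le_baseChange_sup_baseChange _ _ hc
      _ ≤ (⨆ j, K.toSubmodule.baseChange ℂ ⊓ P j) ⊔ (⨆ j, K₀.toSubmodule.baseChange ℂ ⊓ P j) :=
          sup_le_sup K.baseChange_le_iSup_inf K₀.baseChange_le_iSup_inf
      _ ≤ ⨆ j, Q j := sup_le (iSup_mono fun j ↦ le_sup_left) (iSup_mono fun j ↦ le_sup_right)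
  have hind : iSupIndep P := iSupIndep_piece_holds H
  intro x hx
  have hxQ : x ∈ ⨆ j, Q j := hQtop Submodule.mem_top
  rw [iSup_split_single Q i] at hxQ
  obtain ⟨y, hy, z, hz, rfl⟩ := Submodule.mem_sup.1 hxQ
  have hz' : z ∈ ⨆ (j) (_ : j ≠ i), P j := (iSup₂_mono fun j _ ↦ hQP j) hz
  have hzP : z ∈ P i := by
    have hzeq : z = (y + z) - y := by abel
    rw [hzeq]
    exact Submodule.sub_mem _ hx (hQP i hy)
  have hz0 : z = 0 := (Submodule.disjoint_def.1 (hind i)) z hzP hz'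
  rw [hz0, add_zero]
  exact hy

/-- **THE PROJECTION ONTO A COMPLEMENTARY SUB-HODGE STRUCTURE PRESERVES THE HODGE PIECES** (so it is a morphism of Hodge structures —
"`φ` has a left inverse as morphism of Hodge structures", Voisin 2025, proof of Cor. 2.12): for `x ∈ V^{p,q}`, the component of `x` in
`K_ℂ` along `K₀,ℂ` lies in `V^{p,q}`. [cite: Voisin2025, Prop. 2.11 and Cor. 2.12] [cite: VoisinHodgeI2002, Lemma 7.26 and §7.3.1] -/
theorem projection_baseChange_mem_piece (H : Motives.HodgeStructure V n) (K K₀ : SubHodgeStructure H)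
    (hc : IsCompl K.toSubmodule K₀.toSubmodule) {p q : ℤ} {x : ℂ ⊗[ℚ] V} (hx : x ∈ H.piece p q) :
    (K.toSubmodule.projection K₀.toSubmodule hc).baseChange ℂ x ∈ H.piece p q := by
  by_cases hpq : p + q = n
  · obtain rfl : q = n - p := by omega
    obtain ⟨a, ha, b, hb, rfl⟩ := Submodule.mem_sup.1 (piece_le_sup_inf_of_isCompl H K K₀ hc p hx)
    rw [map_add, projection_baseChange_apply_of_mem_left _ _ hc ha.1, projection_baseChange_apply_of_mem_right _ _ hc hb.1,
      add_zero]
    exact ha.2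
  · rw [H.piece_eq_bot_of_add_ne hpq, Submodule.mem_bot] at hx ⊢
    rw [hx, map_zero]

end Abstract

/-! ## §2 Carriers: the Hodge-theoretic Leray idempotent of a morphism of smooth projective varieties -/

section Carriers

variable {n m : ℕ} {X Y : SchemeOver ℂ}

/-- **For every morphism `g : Y ⟶ X` of smooth projective complex varieties and every degree `k` there is an endomorphism `e` of
`Hᵏ(X(ℂ); ℂ)` preserving rational classes and Hodge types, with `g^* ∘ e = g^*` and `e|_{ker g^*} = 0`** — the complexified projection
onto a sub-Hodge structure complementary to `ker (g^* : Hᵏ(X, ℚ) → Hᵏ(Y, ℚ))` (semisimplicity of the polarisable Hodge structure of `X`,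
Voisin 2025 Prop. 2.11, on the tree's model Hodge structures; all inputs tree theorems). [cite: Voisin2025, Prop. 2.11 and Cor. 2.12]
[cite: VoisinHodgeI2002, §7.1.1–7.1.2, Lemma 7.26 and §7.3.2] -/
theorem exists_hodge_idempotent_of_map (hX : IsSmoothProjective n X) (hY : IsSmoothProjective m Y) (g : Y ⟶ X) (k : ℕ) :
    ∃ e : complexBetti X k →ₗ[ℂ] complexBetti X k,
      (∀ w, IsRationalClass w → IsRationalClass (e w)) ∧
      (∀ w, complexBetti.map g k (e w) = complexBetti.map g k w) ∧
      (∀ w, complexBetti.map g k w = 0 → e w = 0) ∧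
      (∀ (p q : ℕ) (c : complexBetti X k), IsOfHodgeType n X k p q c → IsOfHodgeType n X k p q (e c)) := by
  have hI := hodgePQ_independent_of_hodgeModel_holds
  obtain ⟨A, hA⟩ := exists_isReal_hodgeModel_holds n X hX
  obtain ⟨B, hB⟩ := exists_isReal_hodgeModel_holds m Y hY
  have hAs := hA.isHodgeSymmetric
  have hBs := hB.isHodgeSymmetric
  haveI : Module.Finite ℚ (Motives.bettiCohomology X k) := finiteDimensional_bettiCohomology hX k
  -- the model Hodge structures and `g^*` as a morphism
  set φ := A.hodgeStructureHom hX hI hAs B hY hBs g k with hφ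
  set rQ : Motives.bettiCohomology X k →ₗ[ℚ] Motives.bettiCohomology Y k :=
    (Literature.AlgebraicTopology.SingularHomology.singularCohomology.map ℚ ℚ (AlgPoints.mapContinuous (L := ℂ) g) k).hom with hrQ
  have hφr : φ.toLinearMap = rQ := rfl
  -- polarisation, kernel, complement
  obtain ⟨Q⟩ := smoothProjective_hodgeStructure_isPolarizable_holds hX A hAs k
  obtain ⟨K₀, hK₀⟩ := φ.exists_subHodgeStructure_ker
  obtain ⟨K, -, hc⟩ := K₀.exists_isCompl_eq_orthogonal Q
  rw [hφr] at hK₀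
  -- the projection onto `K` along `K₀ = ker g^*`, complexified and read on `Hᵏ(X(ℂ); ℂ)`
  set π : Motives.bettiCohomology X k →ₗ[ℚ] Motives.bettiCohomology X k := K.toSubmodule.projection K₀.toSubmodule hc.symm with hπ
  set β := ofRatClassBaseChangeEquiv hX k with hβ
  set e : complexBetti X k →ₗ[ℂ] complexBetti X k := β.toLinearMap ∘ₗ π.baseChange ℂ ∘ₗ β.symm.toLinearMap with he_def
  have he : ∀ x, e (β x) = β (π.baseChange ℂ x) := fun x ↦ by
    simp only [he_def, LinearMap.comp_apply, LinearEquiv.coe_toLinearMap, LinearEquiv.symm_apply_apply]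
  have hβ' : ∀ x, β x = ofRatClassBaseChange (ComplexPoints X) k x := fun x ↦ rfl
  -- `g^* ∘ π = g^*` on `Hᵏ(X, ℚ)`
  have hrπ : ∀ v, rQ (π v) = rQ v := by
    intro v
    have hmem : v - π v ∈ LinearMap.ker rQ := by
      rw [← hK₀]
      exact Submodule.sub_projection_mem hc.symm v
    rw [LinearMap.mem_ker, map_sub, sub_eq_zero] at hmem
    exact hmem.symm
  have hrπc : ∀ x, rQ.baseChange ℂ (π.baseChange ℂ x) = rQ.baseChange ℂ x := by
    intro x
    rw [← LinearMap.comp_apply, ← LinearMap.baseChange_comp]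
    congr 2
    exact LinearMap.ext hrπ
  -- naturality of `β`: `g^*(β x) = β_Y ((g^* ⊗ ℂ) x)`
  have hnat : ∀ x, complexBetti.map g k (β x) = ofRatClassBaseChange (ComplexPoints Y) k (rQ.baseChange ℂ x) := by
    intro x
    rw [hβ']
    exact (HodgeModel.ofRatClassBaseChange_baseChange_map g k x).symm
  refine ⟨e, ?_, ?_, ?_, ?_⟩
  · -- (Π2) rational classes
    intro w hw
    obtain ⟨v, rfl⟩ := (isRationalClass_iff_mem_range_ofRatClass w).1 hw
    have hx : ofRatClass (ComplexPoints X) k v = β (HodgeStructure.ofRat v) := by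
      rw [hβ', ofRatClassBaseChange_ofRat]
    rw [hx, he, HodgeStructure.ofRat_apply, LinearMap.baseChange_tmul, hβ', ofRatClassBaseChange_tmul, one_smul]
    exact isRationalClass_ofRatClass _
  · -- (π)
    intro w
    obtain ⟨x, rfl⟩ := β.surjective w
    rw [he, hnat, hnat, hrπc]
  · -- (κ)
    intro w hw
    obtain ⟨x, rfl⟩ := β.surjective w
    rw [hnat] at hw
    have hx0 : rQ.baseChange ℂ x = 0 := ofRatClassBaseChange_injective _ k (by rw [hw, map_zero])
    have hxK : x ∈ K₀.toSubmodule.baseChange ℂ := by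
      rw [hK₀]
      exact (mem_baseChange_ker_iff rQ x).2 hx0
    rw [he, projection_baseChange_apply_of_mem_right _ _ hc.symm hxK, map_zero]
  · -- Hodge types
    intro p q c hc'
    obtain ⟨x, rfl⟩ := β.surjective c
    by_cases hpq : p + q = k
    · have hxp : x ∈ (A.hodgeStructure hX hAs k).piece p q := by
        rw [A.piece_eq_ratPiece hX hAs hpq, HodgeModel.mem_ratPiece_iff, HodgeModel.complexification_eq_trans]
        exact (isOfHodgeType_iff_mem_hodgePQ hX A _).1 hc'
      have hπx := projection_baseChange_mem_piece (A.hodgeStructure hX hAs k) K K₀ hc.symm hxp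
      rw [A.piece_eq_ratPiece hX hAs hpq, HodgeModel.mem_ratPiece_iff, HodgeModel.complexification_eq_trans] at hπx
      rw [he]
      exact (isOfHodgeType_iff_mem_hodgePQ hX A _).2 hπx
    · rw [isOfHodgeType_iff_eq_zero_of_add_ne hX hpq] at hc' ⊢
      rw [hc', map_zero]

end Carriers

/-! ## §3 On-path: `HodgeConjecture ⟹` an algebraic Leray idempotent at every point in every degree -/

section OnPath

variable {𝒳 S : SchemeOver ℂ} {d : ℕ} {f : 𝒳 ⟶ S}

/-- **`HodgeConjecture ⟹` an algebraic Leray idempotent with (Π1), (Π2), (π), (κ) at every point `t` of a compact abelian pencil, in every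
degree `2p ≤ 2(d+1)`.** The Hodge-theoretic idempotent `e` of §2 for `j_t` preserves rational classes and Hodge types, so by Voisin I
Lemma 11.41 (tree theorem `exists_hodgeClass_corrAction_eq_smul_holds`) `t·e = γ_*` for a RATIONAL HODGE class `γ ∈ H^{2(d+1)}((𝒳 ⊗ 𝒳)(ℂ))`
and `t ≠ 0`; the Hodge conjecture for the smooth projective `𝒳 ⊗ 𝒳` makes `γ`, hence `t⁻¹ γ`, algebraic, and `e = (t⁻¹γ)_*` is an algebraic
correspondence. The trivial direction: the bracket is a CASE of the summit. [cite: VoisinHodgeI2002, §11.3.3 Lemma 11.41] [cite: Deligne2000, §1]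
[cite: Voisin2025, Prop. 2.11] -/
theorem exists_lerayIdempotent_of_hodgeConjecture (hHC : _root_.HodgeConjecture) (hf : IsCompactAbelianPencil f d)
    (t : ComplexPoints S) {p : ℕ} (hp : p ≤ d + 1) :
    ∃ e : complexBetti 𝒳 (2 * p) →ₗ[ℂ] complexBetti 𝒳 (2 * p),
      IsAlgebraicCorrespondence (d + 1) (d + 1) 𝒳 𝒳 e ∧ (∀ w, IsRationalClass w → IsRationalClass (e w)) ∧
      (∀ w, complexBetti.map (fiberι f t) (2 * p) (e w) = complexBetti.map (fiberι f t) (2 * p) w) ∧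
      (∀ w, complexBetti.map (fiberι f t) (2 * p) w = 0 → e w = 0) := by
  have h𝒳 := hf.isSmoothProjective_total
  have hXt := hf.isSmoothProjective_fiberOver t
  obtain ⟨e, hQ, hπ, hκ, htyp⟩ := exists_hodge_idempotent_of_map h𝒳 hXt (fiberι f t) (2 * p)
  obtain ⟨A, -⟩ := exists_isReal_hodgeModel_holds (d + 1) 𝒳 h𝒳
  have hab : 2 * p + 2 * (d + 1) = 2 * p + 2 * (d + 1) := rfl
  -- Voisin I, Lemma 11.41: `t • e = γ_*` for a rational Hodge class `γ` on `𝒳 ⊗ 𝒳`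
  obtain ⟨γ, hγQ, hγH, c, hc, hcorr⟩ := exists_hodgeClass_corrAction_eq_smul_holds h𝒳 h𝒳 A A hab
    (show (d + 1) + 0 = d + 1 by omega) e hQ
    (fun p' q' _ x hx ↦
      (isOfHodgeType_iff_mem_hodgePQ h𝒳 A _).1 (htyp p' q' x ((isOfHodgeType_iff_mem_hodgePQ h𝒳 A _).2 hx)))
    complexOrientationFamily
  -- the Hodge conjecture for `𝒳 ⊗ 𝒳` makes `γ` algebraic
  have hγalg : γ ∈ algebraicClasses (𝒳 ⊗ 𝒳) (d + 1) := (hHC (IsSmoothProjective.tensor_holds h𝒳 h𝒳)).2 (d + 1) γ hγQ hγH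
  have he : e = corrAction complexOrientationFamily h𝒳 h𝒳 hab (c⁻¹ • γ) := by
    rw [map_smul, hcorr, smul_smul, inv_mul_cancel₀ hc, one_smul]
  refine ⟨e, ?_, hQ, hπ, hκ⟩
  rw [he]
  exact isAlgebraicCorrespondence_corrAction_complex h𝒳 h𝒳 hab (by omega) (Submodule.smul_mem _ _ hγalg)

end OnPath

/-! ## §4 Node level: `CMLerayIdempotent[]` is a case of the summit -/

section Nodes

/-- DISPLAY-ONLY bracket (no `def`; REFEREE-AB F-ab-103): `CMLerayIdempotent[]` of part XXVII-c, restated verbatim. -/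
local notation3 (prettyPrint := false) "CMLerayIdempotent[]" =>
  ∀ ⦃d : ℕ⦄ ⦃𝒳 S : SchemeOver ℂ⦄ (f : 𝒳 ⟶ S), IsCompactAbelianPencil f d → ∀ t ∈ cmLocus f d, ∀ p : ℕ, p ≤ d →
    ∃ e : complexBetti 𝒳 (2 * p) →ₗ[ℂ] complexBetti 𝒳 (2 * p),
      IsAlgebraicCorrespondence (d + 1) (d + 1) 𝒳 𝒳 e ∧ (∀ w, IsRationalClass w → IsRationalClass (e w)) ∧
      (∀ w, complexBetti.map (fiberι f t) (2 * p) (e w) = complexBetti.map (fiberι f t) (2 * p) w) ∧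
      (∀ w, complexBetti.map (fiberι f t) (2 * p) w = 0 → e w = 0)

/-- **ON-PATH: `HodgeConjecture ⟹ CMLerayIdempotent[]`** — the displayed hypothesis of the André-axis exactness rows of part XXVII-c is a
CASE OF THE SUMMIT (§3 at the CM points; the CM structure plays no role). With parts XXVII-c and XXIV–XXVI: every displayed hypothesis of
`HC_AV ⟺ HC_CM ∧ CMIdempotentHodge[]` other than the Literature facts [h₂₁] and Verdier is now implied by `HodgeConjecture`; (θ∀)
`PencilTheta[]` (a statement about morphisms of schemes) was not. research route, not a corollary; conditional on HC_CM plus one named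
minimal statement. [cite: VoisinHodgeI2002, §11.3.3 Lemma 11.41] [cite: Voisin2025, Prop. 2.11] [cite: Deligne2000, §1] -/
theorem cmLerayIdempotent_of_hodgeConjecture (hHC : _root_.HodgeConjecture) : CMLerayIdempotent[] :=
  fun _ _ _ _ hf t _ _ hp ↦ exists_lerayIdempotent_of_hodgeConjecture hHC hf t (by omega)

end Nodes

end Summit.HodgeConjecture.HodgeConjecture.Ring2.AbelianAll

end
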